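import Literature.Geometry.Kaehler.ConeConditionLine
import Literature.Geometry.Kaehler.AnalyticSetIsolatingPlanes
import Literature.Geometry.Kaehler.LelongTheorem
import Literature.Analysis.Complex.OsgoodProofs
import HarnessLib

/-!
# Directions with the cone condition at a point of an analytic set

For an analytic set `A` of dimension `≤ p` at `a` in a complex normed space `E` of dimension
`n = j + p`, there is an injective linear `ι : ℂʲ → E` such that the plane `a + im ι` is not only
isolating (`a` isolated in `A ∩ (a + im ι)`, [Chirka1989, §3.5],
`Literature/Geometry/Kaehler/AnalyticSetIsolatingPlanes.lean`) but satisfies the stronger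
**cone condition**: `θ ‖z - a‖ ≤ ‖z - a - ι w‖` for all `w` and all `z ∈ A` near `a`
(`exists_direction_cone_condition_aux`, `exists_direction_cone_condition`) — i.e. `im ι` meets
the tangent cone `C(A, a)` only at `0`, equivalently `‖z - a‖ ≤ C ‖π(z - a)‖` on `A` near `a` for
any projection `π` with kernel `im ι`, the hypothesis of the comparison theorem for Lelong numbers
[Demailly, *Complex analytic and differential geometry*, Ch. III Thm. 7.7 / (7.8)] used in the
proof that `n(A, a) = μ_a(A)` is the multiplicity of a good projection [Chirka1989, §15.1 Prop. 2,
§11.2].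

The construction is the induction of `exists_isolating_succ` with the isolating line replaced by
a line transversal to the initial form of an equation of the projected set
(`exists_line_cone_condition`, `ConeConditionLine.lean`): in adapted coordinates
`Θ : E ≃ K × ℂʲ` the projection of `A` to `K` is analytic at `a₁` (`isZeroSetAt_image_fst`) and
not a neighbourhood (else the cover would produce regular points of `A` of codimension `j`), so it
lies in a hypersurface `{g = 0}`, `g ≢ 0`; a direction `v` with `in(g)(v) ≠ 0` gives the cone
condition for the projected set along `ℂ v`, which combines with the inductive cone condition
for `ι` into the cone condition for `ι' = Θ⁻¹ ∘ (v, ι)`.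

## References

* E. M. Chirka, *Complex Analytic Sets*, Kluwer 1989, §3.5, §8.1 Prop. 1, §8.4 [Chirka1989].
-/

noncomputable section

open scoped Manifold Topology
open Set Filter Metric Function Module

namespace Literature.Geometry.Kaehler

namespace SCV

open Literature.Analysis.Complex.SCV Literature.Analysis.Complex.SCV.CoverSetup

variable {E : Type*} [NormedAddCommGroup E] [NormedSpace ℂ E]

/-! ### The cone condition along a line, for a set cut out by equations -/

/-- **A line with the cone condition for an analytic germ which is not a neighbourhood.** If `Z` is
cut out by holomorphic equations near `a ∈ Z` and `Z` is not a neighbourhood of `a` (finite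
dimension), there are `v ≠ 0` and `θ > 0` with `θ ‖y - a‖ ≤ ‖y - a - t v‖` for all `t ∈ ℂ` and all
`y ∈ Z` near `a` (a component `g ≢ 0` of the equations and `exists_line_cone_condition`).
[cite: Chirka1989, §8.1 Prop. 1, §8.4 Lemma 1] -/
theorem exists_line_cone_condition_of_isZeroSetAt [FiniteDimensional ℂ E] {Z : Set E} {a : E}
    (hZ : IsZeroSetAt Z a) (haZ : a ∈ Z) (hnot : Z ∉ 𝓝 a) :
    ∃ v : E, v ≠ 0 ∧ ∃ θ : ℝ, 0 < θ ∧
      ∀ᶠ y in 𝓝 a, y ∈ Z → ∀ t : ℂ, θ * ‖y - a‖ ≤ ‖y - a - t • v‖ := by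
  obtain ⟨U, hU, haU, N, g, hg, hZU⟩ := hZ
  have hga : g a = 0 := (hZU.subset ⟨haZ, haU⟩).2
  obtain ⟨l, hl⟩ : ∃ l, ¬ (fun y => g y l) =ᶠ[𝓝 a] 0 := by
    by_contra hall
    simp only [not_exists, not_not] at hall
    apply hnot
    have h0 : ∀ᶠ y in 𝓝 a, g y = 0 :=
      (Filter.eventually_all.2 hall).mono fun y hy => funext fun l => hy l
    filter_upwards [h0, hU.mem_nhds haU] with y hy hyU
    exact (hZU.symm.subset ⟨hyU, hy⟩).1
  have hgl : AnalyticAt ℂ (fun y => g y l) a :=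
    Literature.Analysis.Complex.SCV.analyticOnNhd_of_differentiableOn (differentiableOn_pi.1 hg l) hU a haU
  obtain ⟨v, hv0, θ, hθ, hev⟩ := exists_line_cone_condition hgl (by simp [hga]) hl
  refine ⟨v, hv0, θ, hθ, ?_⟩
  filter_upwards [hev, hU.mem_nhds haU] with y hy hyU hyZ t
  have hgy : g y = 0 := (hZU.subset ⟨hyZ, hyU⟩).2
  exact hy (by rw [hgy]; rfl) t

/-! ### The induction -/

/-- **The cone condition implies isolation**: if `θ ‖z - a‖ ≤ ‖z - a - ι w‖` on `A` near `a` for an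
injective `ι`, then `a` is isolated in `A ∩ (a + im ι)`. [folklore] -/
theorem eventually_notMem_of_cone_condition {A : Set E} {a : E} {j : ℕ} {ι : (Fin j → ℂ) →L[ℂ] E}
    (hι : Injective ι) {θ : ℝ} (hθ : 0 < θ)
    (h : ∀ᶠ z in 𝓝 a, z ∈ A → ∀ w, θ * ‖z - a‖ ≤ ‖z - a - ι w‖) :
    ∀ᶠ w in 𝓝[≠] (0 : Fin j → ℂ), a + ι w ∉ A := by
  have hc : Tendsto (fun w : Fin j → ℂ => a + ι w) (𝓝 0) (𝓝 a) := by
    have : Continuous fun w : Fin j → ℂ => a + ι w := by fun_prop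
    simpa using this.tendsto 0
  rw [eventually_nhdsWithin_iff]
  filter_upwards [hc.eventually h] with w hw hw0 hwA
  have := hw hwA w
  rw [add_sub_cancel_left, sub_self, norm_zero] at this
  have hιw : ι w = 0 := by
    have h1 : θ * ‖ι w‖ ≤ 0 := this
    have h2 : ‖ι w‖ ≤ 0 := by
      by_contra hpos
      exact absurd h1 (not_le.2 (mul_pos hθ (not_le.1 hpos)))
    exact norm_le_zero_iff.1 h2
  exact hw0 (hι (by rw [hιw, map_zero]))

variable [FiniteDimensional ℂ E]

/-- **Directions with the cone condition, by induction on the number of directions.** Let `A` be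
cut out by holomorphic equations near `a ∈ A` with all regular points of `A` near `a` of
codimension `q ≥ dim E - p` ("`dim_a A ≤ p`"). Then for every `j` with `j + p ≤ dim E` there are an
injective linear `ι : ℂʲ → E` and `θ > 0` with `θ ‖z - a‖ ≤ ‖z - a - ι w‖` for all `w` and all
`z ∈ A` near `a`. [cite: Chirka1989, §8.1 Prop. 1, §3.5 Prop. 1] -/
theorem exists_direction_cone_condition_aux {A : Set E} {a : E} {p : ℕ} (hA : IsZeroSetAt A a)
    (haA : a ∈ A) (hdim : ∀ᶠ x in 𝓝 a, x ∈ A → ∀ q, IsRegPt A q x → finrank ℂ E ≤ q + p) :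
    ∀ j : ℕ, j + p ≤ finrank ℂ E → ∃ ι : (Fin j → ℂ) →L[ℂ] E, Injective ι ∧ ∃ θ : ℝ, 0 < θ ∧
      ∀ᶠ z in 𝓝 a, z ∈ A → ∀ w, θ * ‖z - a‖ ≤ ‖z - a - ι w‖ := by
  classical
  set n := finrank ℂ E with hn
  -- the neighbourhood of `a` on which the dimension bound holds
  obtain ⟨Nset, hNsub, hNo, haN⟩ := _root_.mem_nhds_iff.1 hdim
  intro j
  induction j with
  | zero =>
    intro _
    refine ⟨0, injective_of_subsingleton _, 1, one_pos, Eventually.of_forall fun z _ w => ?_⟩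
    simp
  | succ j ih =>
    intro hj
    obtain ⟨ι, hι, θ, hθ, hcone⟩ := ih (by omega)
    have hiso : ∀ᶠ w in 𝓝[≠] (0 : Fin j → ℂ), a + ι w ∉ A :=
      eventually_notMem_of_cone_condition hι hθ hcone
    -- `A` is not a neighbourhood of `a` (as `p < dim E`)
    have hAn : A ∉ 𝓝 a := by
      intro hAa
      obtain ⟨ρ, hρ, hball⟩ := Metric.mem_nhds_iff.1 hAa
      have h0 : IsRegPt A 0 a := isRegPt_zero_of_ball_subset hball (mem_ball_self hρ)
      have h1 := hNsub haN haA 0 h0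
      omega
    cases j with
    | zero =>
      -- a line with the cone condition for `A` itself
      obtain ⟨v, hv0, θ', hθ', hev⟩ := exists_line_cone_condition_of_isZeroSetAt hA haA
        (fun h => hAn h)
      refine ⟨lineEmb v, (exists_lineEmb_of_isolated (Z := A) (a := a) hv0 ?_).1, θ', hθ', ?_⟩
      · -- isolation along the line (from the cone condition)
        have hc : Tendsto (fun t : ℂ => a + t • v) (𝓝 0) (𝓝 a) := by
          have : Continuous fun t : ℂ => a + t • v := by fun_prop
          simpa using this.tendsto 0
        rw [eventually_nhdsWithin_iff]
        filter_upwards [hc.eventually hev] with t ht ht0 htA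
        have := ht htA t
        rw [add_sub_cancel_left, sub_self, norm_zero, norm_smul] at this
        have h1 : ‖t‖ * ‖v‖ ≤ 0 := by
          by_contra hpos
          exact absurd this (not_le.2 (mul_pos hθ' (not_le.1 hpos)))
        have h2 : 0 < ‖t‖ * ‖v‖ := mul_pos (norm_pos_iff.2 ht0) (norm_pos_iff.2 hv0)
        linarith
      · filter_upwards [hev] with z hz hzA u
        have : (lineEmb v) u = u 0 • v := rfl
        rw [this]
        exact hz hzA (u 0)
    | succ j' =>
      -- adapted coordinates `Θ : E ≃ K × ℂ^{j'+1}` with `Θ (ι w) = (0, w)`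
      obtain ⟨K, Θ, hΘι⟩ := exists_equiv_adapted ι hι
      set a₁ : K := (Θ a).1 with ha₁
      set a₂ : Fin (j' + 1) → ℂ := (Θ a).2 with ha₂
      have hΘa : Θ a = (a₁, a₂) := rfl
      -- equations of `Θ '' A` near `Θ a`, inside `Θ '' Nset`
      obtain ⟨U₀, hU₀o, haU₀, N₀, f, hf, hZU₀⟩ := hA.image_equiv Θ
      set U₁ : Set (K × (Fin (j' + 1) → ℂ)) := U₀ ∩ Θ '' Nset with hU₁
      have hU₁o : IsOpen U₁ := hU₀o.inter (Θ.toHomeomorph.isOpenMap Nset hNo)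
      have haU₁ : Θ a ∈ U₁ := ⟨haU₀, mem_image_of_mem Θ haN⟩
      have hZU₁ : Θ '' A ∩ U₁ = U₁ ∩ f ⁻¹' {0} := by
        ext x
        constructor
        · rintro ⟨hxA, hxU₁⟩
          exact ⟨hxU₁, (hZU₀.subset ⟨hxA, hxU₁.1⟩).2⟩
        · rintro ⟨hxU₁, hx0⟩
          exact ⟨(hZU₀.symm.subset ⟨hxU₁.1, hx0⟩).1, hxU₁⟩
      -- isolation of `a₂` in the fibre of `Θ '' A` over `a₁`
      have hisoT : ∀ᶠ w in 𝓝[≠] a₂, f (a₁, w) ≠ 0 := by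
        have hpt : ∀ w, ((a₁, w) : K × (Fin (j' + 1) → ℂ)) = Θ (a + ι (w - a₂)) := by
          intro w
          rw [map_add, hΘι, hΘa, Prod.mk_add_mk, add_zero, add_sub_cancel]
        have ht : Tendsto (fun w : Fin (j' + 1) → ℂ => w - a₂) (𝓝[≠] a₂) (𝓝[≠] 0) := by
          refine tendsto_nhdsWithin_of_tendsto_nhds_of_eventually_within _ ?_ ?_
          · have : Tendsto (fun w : Fin (j' + 1) → ℂ => w - a₂) (𝓝 a₂) (𝓝 (a₂ - a₂)) :=
              (continuous_id.sub continuous_const).continuousAt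
            rw [sub_self] at this
            exact this.mono_left nhdsWithin_le_nhds
          · exact eventually_nhdsWithin_of_forall fun w hw h0 => hw (sub_eq_zero.1 h0)
        have hmemU₀ : ∀ᶠ w in 𝓝[≠] a₂, ((a₁, w) : K × (Fin (j' + 1) → ℂ)) ∈ U₀ := by
          have hc : Continuous fun w : Fin (j' + 1) → ℂ => ((a₁, w) : K × (Fin (j' + 1) → ℂ)) := by
            fun_prop
          exact nhdsWithin_le_nhds (hc.continuousAt.preimage_mem_nhds (hU₀o.mem_nhds (hΘa ▸ haU₀)))
        filter_upwards [ht.eventually hiso, hmemU₀] with w hw hwU₀ hf0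
        apply hw
        have hmem : ((a₁, w) : K × (Fin (j' + 1) → ℂ)) ∈ (Θ '' A) ∩ U₀ := by
          rw [hZU₀]; exact ⟨hwU₀, hf0⟩
        obtain ⟨z, hzA, hz⟩ := hmem.1
        rw [hpt w] at hz
        exact Θ.injective hz ▸ hzA
      -- the cover set-up at `Θ a`, inside `U₁`
      obtain ⟨ε, r, C, F, rr, RR, hS, hsubU₁⟩ :=
        exists_coverSetup hU₁o (hf.mono inter_subset_left) haU₁ hisoT
      set P : Set (K × (Fin (j' + 1) → ℂ)) := ball a₁ ε ×ˢ ball a₂ r with hP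
      have hPo : IsOpen P := isOpen_ball.prod isOpen_ball
      have haP : Θ a ∈ P := ⟨mem_ball_self hS.ε_pos, mem_ball_self hS.r_pos⟩
      have hPU₁ : P ⊆ U₁ := fun x hx => hsubU₁ ⟨hx.1, ball_subset_closedBall hx.2⟩
      have hfP : DifferentiableOn ℂ f P := (hf.mono inter_subset_left).mono hPU₁
      -- the image of the zero set in the base
      obtain ⟨V, hVo, haV, hVP, hZ''⟩ := isZeroSetAt_image_fst (j' + 1) hPo hfP haP hisoT
      set Z'' : Set K := Prod.fst '' (V ∩ f ⁻¹' {0}) with hZ''def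
      have hfa : f (Θ a) = 0 := (hZU₁.subset ⟨mem_image_of_mem Θ haA, haU₁⟩).2
      have ha₁Z : a₁ ∈ Z'' := ⟨Θ a, ⟨haV, hfa⟩, rfl⟩
      -- the image is not a neighbourhood of `a₁`
      have hnot : Z'' ∉ 𝓝 a₁ := by
        intro hZn
        obtain ⟨Δ, hΔd, hΔne, hcov⟩ := hS.exists_cover_structure
        have hfreq : ∃ᶠ z in 𝓝 a₁, Δ z ≠ 0 := by
          have := hΔne a₁ (mem_ball_self hS.ε_pos)
          simpa [Filter.EventuallyEq, Filter.not_eventually] using this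
        obtain ⟨z₀, hΔz₀, hz₀Z, hz₀b⟩ :=
          (hfreq.and_eventually (inter_mem hZn (ball_mem_nhds a₁ hS.ε_pos))).exists
        obtain ⟨x₀, ⟨hx₀V, hx₀f⟩, hx₀z⟩ := hz₀Z
        obtain ⟨δ, hδ, hδsub, nn, σ, hσd, hσinj, -, hσiff⟩ := hcov z₀ hz₀b hΔz₀
        have hw₀ : x₀.2 ∈ ball a₂ r := (hVP hx₀V).2
        have hx₀eq : x₀ = (z₀, x₀.2) := by rw [← hx₀z]
        obtain ⟨jj, hjj⟩ := (hσiff z₀ (mem_ball_self hδ) x₀.2 (ball_subset_closedBall hw₀)).1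
          (by rw [← hx₀eq]; exact hx₀f)
        have hw₀' : σ jj z₀ ∈ ball a₂ r := hjj ▸ hw₀
        have hreg : IsRegPt (Θ '' A) (j' + 1) (z₀, σ jj z₀) := by
          refine isRegPt_of_sheets hδ hσd hσinj (fun z' hz' w hw => ?_) jj hw₀'
          have hmemP : ((z', w) : K × (Fin (j' + 1) → ℂ)) ∈ P := ⟨hδsub hz', hw⟩
          rw [← hσiff z' hz' w (ball_subset_closedBall hw)]
          constructor
          · intro h; exact (hZU₁.subset ⟨h, hPU₁ hmemP⟩).2
          · intro h; exact (hZU₁.symm.subset ⟨hPU₁ hmemP, h⟩).1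
        have hregA : IsRegPt A (j' + 1) (Θ.symm (z₀, σ jj z₀)) := by
          have := hreg.image_equiv Θ.symm
          simpa [Set.image_image] using this
        have hmemU₁ : ((z₀, σ jj z₀) : K × (Fin (j' + 1) → ℂ)) ∈ U₁ :=
          hPU₁ ⟨hδsub (mem_ball_self hδ), hw₀'⟩
        have hxN : Θ.symm (z₀, σ jj z₀) ∈ Nset := by
          obtain ⟨y, hyN, hy⟩ := hmemU₁.2
          rw [← hy, ContinuousLinearEquiv.symm_apply_apply]; exact hyN
        have hxA : Θ.symm (z₀, σ jj z₀) ∈ A := by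
          have hmem : ((z₀, σ jj z₀) : K × (Fin (j' + 1) → ℂ)) ∈ Θ '' A ∩ U₁ := by
            rw [hZU₁]
            refine ⟨hmemU₁, ?_⟩
            show f (z₀, σ jj z₀) = 0
            exact (hσiff z₀ (mem_ball_self hδ) _ (ball_subset_closedBall hw₀')).2 ⟨jj, rfl⟩
          obtain ⟨y, hyA, hy⟩ := hmem.1
          rw [← hy, ContinuousLinearEquiv.symm_apply_apply]; exact hyA
        have := hNsub hxN hxA (j' + 1) hregA
        omega
      -- a line in the base with the cone condition for `Z''`
      obtain ⟨v, hv0, θ', hθ', hev⟩ := exists_line_cone_condition_of_isZeroSetAt hZ'' ha₁Z hnot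
      -- the new embedding
      set ι' : (Fin (j' + 2) → ℂ) →L[ℂ] E :=
        (Θ.symm : (K × (Fin (j' + 1) → ℂ)) →L[ℂ] E).comp (lineProdMap v j') with hι'
      have hΘι' : ∀ u, Θ (ι' u) = (u 0 • v, Fin.tail u) := fun u => by
        rw [hι']; simp [lineProdMap_apply]
      refine ⟨ι', Θ.symm.injective.comp (lineProdMap_injective hv0 j'), ?_⟩
      -- constants
      set CΘ : ℝ := max ‖(Θ : E →L[ℂ] K × (Fin (j' + 1) → ℂ))‖ 1 with hCΘ
      set CS : ℝ := max ‖(Θ.symm : (K × (Fin (j' + 1) → ℂ)) →L[ℂ] E)‖ 1 with hCS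
      set M : ℝ := max θ'⁻¹ 1 with hM
      have hCΘpos : 0 < CΘ := lt_max_of_lt_right one_pos
      have hCSpos : 0 < CS := lt_max_of_lt_right one_pos
      have hMpos : 0 < M := lt_max_of_lt_right one_pos
      refine ⟨θ / (CS * M * CΘ), by positivity, ?_⟩
      -- the neighbourhood: old cone condition, `Θ z ∈ V`, line condition at `(Θ z).1`
      have h1 : ∀ᶠ z in 𝓝 a, Θ z ∈ V := Θ.continuous.continuousAt.preimage_mem_nhds (hVo.mem_nhds haV)
      have h2 : ∀ᶠ z in 𝓝 a, (Θ z).1 ∈ Z'' → ∀ t : ℂ, θ' * ‖(Θ z).1 - a₁‖ ≤ ‖(Θ z).1 - a₁ - t • v‖ :=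
        (continuous_fst.comp Θ.continuous).continuousAt.preimage_mem_nhds hev
      filter_upwards [hcone, h1, h2] with z hz hzV hzline hzA u
      -- notation
      set η : K := (Θ z).1 - a₁ with hη
      set ζ : Fin (j' + 1) → ℂ := (Θ z).2 - a₂ with hζ
      have hy : (Θ z).1 ∈ Z'' := by
        refine ⟨Θ z, ⟨hzV, ?_⟩, rfl⟩
        exact (hZU₁.subset ⟨mem_image_of_mem Θ hzA, hPU₁ (hVP hzV)⟩).2
      have hΘza : Θ (z - a) = (η, ζ) := by
        rw [map_sub, hΘa]; rfl
      -- (i) the old condition with `w = tail u`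
      have hold : θ * ‖z - a‖ ≤ CS * max ‖η‖ ‖ζ - Fin.tail u‖ := by
        have h := hz hzA (Fin.tail u)
        have heq : z - a - ι (Fin.tail u) = Θ.symm (η, ζ - Fin.tail u) := by
          apply Θ.injective
          rw [ContinuousLinearEquiv.apply_symm_apply, map_sub, hΘza, hΘι, Prod.mk_sub_mk, sub_zero]
        rw [heq] at h
        refine h.trans ?_
        calc ‖Θ.symm (η, ζ - Fin.tail u)‖
            ≤ ‖(Θ.symm : (K × (Fin (j' + 1) → ℂ)) →L[ℂ] E)‖ * ‖(η, ζ - Fin.tail u)‖ :=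
              (Θ.symm : (K × (Fin (j' + 1) → ℂ)) →L[ℂ] E).le_opNorm _
          _ ≤ CS * max ‖η‖ ‖ζ - Fin.tail u‖ := by
              rw [Prod.norm_def]
              exact mul_le_mul_of_nonneg_right (le_max_left _ _) (by positivity)
      -- (ii) the line condition
      have hline : θ' * ‖η‖ ≤ ‖η - u 0 • v‖ := hzline hy (u 0)
      -- (iii) `max ‖η‖ ‖ζ - tail u‖ ≤ M · ‖Θ (z - a - ι' u)‖ ≤ M CΘ ‖z - a - ι' u‖`
      have hΘnew : Θ (z - a - ι' u) = (η - u 0 • v, ζ - Fin.tail u) := by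
        rw [map_sub, hΘza, hΘι', Prod.mk_sub_mk]
      have hmax : max ‖η‖ ‖ζ - Fin.tail u‖ ≤ M * ‖Θ (z - a - ι' u)‖ := by
        rw [hΘnew, Prod.norm_def]
        refine max_le ?_ ?_
        · have hη' : ‖η‖ ≤ θ'⁻¹ * ‖η - u 0 • v‖ := by
            rw [le_inv_mul_iff₀ hθ']; exact hline
          exact hη'.trans (mul_le_mul (le_max_left _ _) (le_max_left _ _) (norm_nonneg _) hMpos.le)
        · calc ‖ζ - Fin.tail u‖ = 1 * ‖ζ - Fin.tail u‖ := (one_mul _).symm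
            _ ≤ M * max ‖η - u 0 • v‖ ‖ζ - Fin.tail u‖ :=
                mul_le_mul (le_max_right _ _) (le_max_right _ _) (norm_nonneg _) hMpos.le
      have hop : ‖Θ (z - a - ι' u)‖ ≤ CΘ * ‖z - a - ι' u‖ :=
        ((Θ : E →L[ℂ] K × (Fin (j' + 1) → ℂ)).le_opNorm _).trans
          (mul_le_mul_of_nonneg_right (le_max_left _ _) (norm_nonneg _))
      -- combine
      rw [div_mul_eq_mul_div, div_le_iff₀ (by positivity)]
      calc θ * ‖z - a‖ ≤ CS * max ‖η‖ ‖ζ - Fin.tail u‖ := hold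
        _ ≤ CS * (M * (CΘ * ‖z - a - ι' u‖)) := by
            gcongr
            exact hmax.trans (mul_le_mul_of_nonneg_left hop hMpos.le)
        _ = ‖z - a - ι' u‖ * (CS * M * CΘ) := by ring

/-! ### The manifold-level statement for pure-dimensional analytic subsets -/

variable {V : Type*} [NormedAddCommGroup V] [NormedSpace ℂ V] [FiniteDimensional ℂ V]
  {Ω : TopologicalSpace.Opens V}

/-- **A direction with the cone condition at a point of a pure `(q+1)`-dimensional analytic set.**
For `A ⊆ Ω` of pure dimension `q + 1`, `a ∈ A`, `dim V = (m + 1) + (q + 1)`, there is an injective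
linear `ι : ℂ^{m+1} → V` and `θ > 0` with `θ ‖z - a‖ ≤ ‖z - a - ι w‖` for all `w` and all
`z ∈ A` near `a`; in particular `a` is isolated in `A ∩ (a + im ι)`.
[cite: Chirka1989, §8.1 Prop. 1, §3.5 Prop. 1] -/
theorem exists_direction_cone_condition {A : Set Ω} {q : ℕ} (hA : HasPureDim 𝓘(ℂ, V) A (q + 1))
    {a : V} (haA : a ∈ ((↑) : Ω → V) '' A) {m : ℕ} (hdim : finrank ℂ V = (m + 1) + (q + 1)) :
    ∃ ι : (Fin (m + 1) → ℂ) →L[ℂ] V, Injective ι ∧ ∃ θ : ℝ, 0 < θ ∧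
      (∀ᶠ z in 𝓝 a, z ∈ ((↑) : Ω → V) '' A → ∀ w, θ * ‖z - a‖ ≤ ‖z - a - ι w‖) ∧
      ∀ᶠ w in 𝓝[≠] (0 : Fin (m + 1) → ℂ), a + ι w ∉ ((↑) : Ω → V) '' A := by
  have haΩ : a ∈ (Ω : Set V) := by
    obtain ⟨y, -, rfl⟩ := haA; exact y.2
  have hA' : IsZeroSetAt (((↑) : Ω → V) '' A) a := hA.isZeroSetAt_image_coe haΩ
  have hdim' : ∀ᶠ x in 𝓝 a, x ∈ ((↑) : Ω → V) '' A → ∀ q', IsRegPt (((↑) : Ω → V) '' A) q' x →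
      finrank ℂ V ≤ q' + (q + 1) :=
    Eventually.of_forall fun x hx q' hq' => hA.finrank_le_of_isRegPt_image_coe ⟨hx, q', hq'⟩ hq'
  obtain ⟨ι, hι, θ, hθ, hcone⟩ := exists_direction_cone_condition_aux hA' haA hdim' (m + 1) (by omega)
  exact ⟨ι, hι, θ, hθ, hcone, eventually_notMem_of_cone_condition hι hθ hcone⟩

end SCV

end Literature.Geometry.Kaehler

end
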